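import Summits.ResolutionOfSingularities.ResolutionOfSingularities.Theorems.WildConesClassicalRegimesStubMuDropCharTwoOrdPGeneric
import Summits.ResolutionOfSingularities.ResolutionOfSingularities.Theorems.WildConesClassicalRegimesStubCaseAExitOrdSucc
import Summits.ResolutionOfSingularities.ResolutionOfSingularities.Theorems.WildConesNarrowRunsDieStubDict

/-!
# Milnor drop in characteristic two (`stub_muDropCharTwoOrdP`) — the DICTIONARY WRAPPER (piece D)

Helper file for the one open stub `stub_muDropCharTwoOrdP` of crux `ClassicalRegimes`
(stmt-ResolutionOfSingularities-16884, route `WildCones`, line `milnor-descent`; chain W4.1 of the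
res-hironaka rescue branch, `L/w41/CHAIN.md` piece (D)). The eight landed helper files
`…StubMuDropCharTwoOrdP{Generic,BlowFam,Reduction,Descent,Leaves,Jets,Noether,Surface}.lean` prove the
Milnor drop for an abstract FORMAL PAIR `(a, G)` of power series related by the blow-up substitution
`Φ_{i,τ} : X_i ↦ X_i, X_s ↦ X_i (X_s + τ_s)`:

  `X_i ^ 2 * G = a∘Φ_{i,τ}`, `2 ≤ ord a`, `G` without linear terms,
  Milnor algebras `κ⟦X⟧/(∂a)`, `κ⟦X⟧/(∂G)` with `∂ = MvPowerSeries.pderiv`.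

This file supplies that pair FROM THE ROUTE'S DATA — a state `c : (Fin n → ℕ) → κ`, a chart `i`, a
translation `τ`, the route's inlined coefficient calculus `clean/bl/dv/tr/step/ser/pd/jac` (named in
`Theorems/WildConesClassicalRegimesDefs.lean`) — for every `n` and every prime `p` where the statement is
characteristic-free, and in characteristic `p` where cleaning is involved:

* `pd_eq_pderiv`, `jac_eq_span_pderiv` — the route's hand-rolled `pd` IS `MvPowerSeries.pderiv`, so
  `jac p n κ c = (∂₁ a, …, ∂ₙ a)` with `a = ser p n κ c`;
* `natCast_le_order_ser` — `MultP c` gives `p ≤ ord a`;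
* `X_pow_mul_serT_eq_subst` — THE DICTIONARY (the sibling crux's `NarrowRunsDie.stub_dict` at `s = p`):
  `X_i ^ p * T = a∘Φ_{i,τ}` where `T` is the series of the route's `tr i τ p (dv i p (bl i (clean c)))`
  (the successor BEFORE its final cleaning);
* `pderiv_ser_step_eq`, `jac_step_eq_span_pderiv` — cleaning deletes only monomials all of whose
  exponents are divisible by `p`, which have zero gradient in characteristic `p`: the successor's
  Jacobian ideal is `(∂₁ T, …, ∂ₙ T)`;
* `coeff_single_serT` — `MultP (step i τ c)` kills the linear coefficients of `T`;
* `ordP_two_iff_exists_pair` — for `p = 2`, `OrdP c` says exactly that `a` has a square-free quadratic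
  monomial `X_j X_l`, `j ≠ l` (squares are cleaned away);
* `dictCharTwo` — the package for `p = 2`, and `muDrop_of_seriesDrop` — the stub's conclusion from any
  proof of the formal drop (piece (A)/(S)+(L) of the chain), so that the stub closes by one application.

Everything here is elementary bookkeeping (no step of the drop itself). OURS (campaign res-hironaka,
rung L, slot W4.1): statements about this tree's own calculus, NOT statements of any manuscript.
-/

noncomputable section

-- single-problem summit: the doubled namespace component `ResolutionOfSingularities` is forced
set_option linter.dupNamespace false

open scoped BigOperators Classical

open MvPowerSeries

open Literature.AlgebraicGeometry.Resolution

namespace Summit.ResolutionOfSingularities.ResolutionOfSingularities.Theorems.WildCones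

namespace MuDropCharTwoOrdP

variable {p n : ℕ} {κ : Type} [Field κ]

/-! ## The route's `pd`/`jac` versus `MvPowerSeries.pderiv` (characteristic-free) -/

/-- The route's hand-rolled partial derivative `pd` IS the derivation `MvPowerSeries.pderiv` (same
coefficient formula `[u^A] ∂_l f = (A_l + 1) [u^{A + e_l}] f`). [folklore] -/
theorem pd_eq_pderiv (l : Fin n) (f : MvPowerSeries (Fin n) κ) :
    pd n κ l f = MvPowerSeries.pderiv l f := by
  ext A
  rw [MvPowerSeries.coeff_pderiv]
  change ((A l + 1 : ℕ) : κ) * f (A + Finsupp.single l 1) = ((A l : κ) + 1) * f (A + Finsupp.single l 1)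
  push_cast
  rfl

/-- The route's Jacobian ideal is the ideal of the `MvPowerSeries.pderiv`-partials of the cleaned
series `a = ser p n κ c`. [folklore] -/
theorem jac_eq_span_pderiv (c : (Fin n → ℕ) → κ) :
    jac p n κ c = Ideal.span (Set.range fun s => MvPowerSeries.pderiv s (ser p n κ c)) := by
  have h : (fun s => pd n κ s (ser p n κ c)) = fun s => MvPowerSeries.pderiv s (ser p n κ c) :=
    funext fun s => pd_eq_pderiv s _
  change Ideal.span (Set.range fun s => pd n κ s (ser p n κ c)) = _
  rw [h]

/-- `Isol c` is finiteness of the `pderiv`-Milnor algebra of `ser c`. [folklore] -/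
theorem isol_iff_finite_pderiv (c : (Fin n → ℕ) → κ) :
    Isol p n κ c ↔ Module.Finite κ (MvPowerSeries (Fin n) κ ⧸
      Ideal.span (Set.range fun s => MvPowerSeries.pderiv s (ser p n κ c))) := by
  change Module.Finite κ (MvPowerSeries (Fin n) κ ⧸ jac p n κ c) ↔ _
  rw [jac_eq_span_pderiv]

/-- `mu c` is the dimension of the `pderiv`-Milnor algebra of `ser c`. [folklore] -/
theorem mu_eq_finrank_pderiv (c : (Fin n → ℕ) → κ) :
    mu p n κ c = Module.finrank κ (MvPowerSeries (Fin n) κ ⧸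
      Ideal.span (Set.range fun s => MvPowerSeries.pderiv s (ser p n κ c))) := by
  change Module.finrank κ (MvPowerSeries (Fin n) κ ⧸ jac p n κ c) = _
  rw [jac_eq_span_pderiv]

/-! ## Order of the cleaned series -/

/-- Coefficients of `ser`: `[u^A] ser c = clean c A`. [folklore] -/
theorem coeff_ser (c : (Fin n → ℕ) → κ) (A : Fin n →₀ ℕ) :
    coeff A (ser p n κ c) = clean p n κ c ⇑A := rfl

/-- The degree of an exponent is the sum of its entries. [folklore] -/
theorem degree_eq_sum_univ (A : Fin n →₀ ℕ) :
    A.degree = Finset.sum Finset.univ (fun j => A j) := by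
  rw [Finsupp.degree_eq_sum]

/-- `MultP c` ⇒ the cleaned series has order `≥ p`. [folklore] -/
theorem natCast_le_order_ser {c : (Fin n → ℕ) → κ} (hM : MultP p n κ c) :
    (p : ℕ∞) ≤ (ser p n κ c).order := by
  refine MvPowerSeries.nat_le_order (fun A hA => ?_)
  rw [coeff_ser]
  by_contra h
  have := hM.2 (⇑A) h
  rw [← degree_eq_sum_univ] at this
  exact absurd hA (not_lt.mpr (by exact_mod_cast this))

/-- `MultP c` at `p = 2` ⇒ `2 ≤ ord (ser c)` (the form the helper files consume). [folklore] -/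
theorem two_le_order_ser {c : (Fin n → ℕ) → κ} (hM : MultP 2 n κ c) : 2 ≤ (ser 2 n κ c).order :=
  natCast_le_order_ser hM

/-! ## The dictionary: `X_i ^ p · T = (ser c)∘Φ_{i,τ}` -/

/-- The sibling crux's substitution family (with `Classical.dec`) is the helper files' blow-up family
`Φ_{i,τ}`. [folklore] -/
theorem blowFam_classical_eq (i : Fin n) (τ : Fin n → κ) :
    (fun j : Fin n => @ite (MvPowerSeries (Fin n) κ) (j = i) (Classical.dec _) (MvPowerSeries.X i)
      (MvPowerSeries.X i * (MvPowerSeries.X j + MvPowerSeries.C (τ j)))) =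
    (fun s => if s = i then (X i : MvPowerSeries (Fin n) κ) else X i * (X s + C (τ s))) := by
  funext j
  by_cases hj : j = i
  · rw [if_pos hj, if_pos hj]
  · rw [if_neg hj, if_neg hj]

/-- **THE DICTIONARY** (instance of `NarrowRunsDie.stub_dict` at `s = p`): for a state of multiplicity
`p`, `X_i ^ p · T = (ser c)∘Φ_{i,τ}` where `T` is the series of the route's
`tr i τ p (dv i p (bl i (clean c)))` — the successor before its final cleaning. [folklore] -/
theorem X_pow_mul_serT_eq_subst (c : (Fin n → ℕ) → κ) (i : Fin n) (τ : Fin n → κ)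
    (hM : MultP p n κ c) :
    X i ^ p * (show MvPowerSeries (Fin n) κ from
        fun A : Fin n →₀ ℕ => tr n κ i τ p (dv n κ i p (bl n κ i (clean p n κ c))) ⇑A) =
      subst (fun s => if s = i then (X i : MvPowerSeries (Fin n) κ) else X i * (X s + C (τ s)))
        (ser p n κ c) := by
  have h : subst (fun j : Fin n => @ite (MvPowerSeries (Fin n) κ) (j = i) (Classical.dec _)
      (MvPowerSeries.X i) (MvPowerSeries.X i * (MvPowerSeries.X j + MvPowerSeries.C (τ j)))) (ser p n κ c) =
      X i ^ p * (show MvPowerSeries (Fin n) κ from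
        fun A : Fin n →₀ ℕ => tr n κ i τ p (dv n κ i p (bl n κ i (clean p n κ c))) ⇑A) :=
    Summit.ResolutionOfSingularities.ResolutionOfSingularities.Theorems.NarrowRunsDie.stub_dict
      n κ (clean p n κ c) i τ p hM.2
  rw [blowFam_classical_eq] at h
  exact h.symm

/-! ## The successor's gradient: cleaning is invisible to `pderiv` in characteristic `p` -/

/-- Under `MultP c` the successor is the cleaning of `T`: its cleaned series has coefficients
`clean T`. [folklore] -/
theorem coeff_ser_step (c : (Fin n → ℕ) → κ) (i : Fin n) (τ : Fin n → κ) (hM : MultP p n κ c)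
    (A : Fin n →₀ ℕ) :
    coeff A (ser p n κ (step p n κ i τ c)) =
      clean p n κ (tr n κ i τ p (dv n κ i p (bl n κ i (clean p n κ c)))) ⇑A := by
  rw [OrdPExitSurface.step_eq i τ hM, coeff_ser, CaseAExitOrdSucc.clean_clean]

/-- In characteristic `p`, a series and its cleaning have the same partial derivatives (a deleted
monomial `u^A`, `p ∣ A_j` for all `j`, contributes `A_l [u^A] = 0` to `∂_l`). General `n`, general
prime `p`; the `n = 2` instance is `MuDropSurface.pd_ser_step_eq`. [folklore] -/
theorem pderiv_ser_step_eq [CharP κ p] (c : (Fin n → ℕ) → κ) (i : Fin n) (τ : Fin n → κ)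
    (hM : MultP p n κ c) (l : Fin n) :
    MvPowerSeries.pderiv l (ser p n κ (step p n κ i τ c)) =
      MvPowerSeries.pderiv l (show MvPowerSeries (Fin n) κ from
        fun A : Fin n →₀ ℕ => tr n κ i τ p (dv n κ i p (bl n κ i (clean p n κ c))) ⇑A) := by
  ext A
  rw [MvPowerSeries.coeff_pderiv, MvPowerSeries.coeff_pderiv, coeff_ser_step c i τ hM]
  change _ * clean p n κ _ ⇑(A + Finsupp.single l 1 : Fin n →₀ ℕ) =
    _ * tr n κ i τ p _ ⇑(A + Finsupp.single l 1 : Fin n →₀ ℕ)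
  unfold clean
  by_cases h : ∀ j, p ∣ (⇑(A + Finsupp.single l 1 : Fin n →₀ ℕ)) j
  · have hl : p ∣ A l + 1 := by simpa using h l
    have h0 : ((A l : κ) + 1) = 0 := by
      have : ((A l : κ) + 1) = ((A l + 1 : ℕ) : κ) := by push_cast; ring
      rw [this]
      exact (CharP.cast_eq_zero_iff κ p _).mpr hl
    rw [h0, zero_mul, zero_mul]
  · rw [if_neg h]

/-- **The successor's Jacobian ideal** is the ideal of partials of `T` (characteristic `p`).
[folklore] -/
theorem jac_step_eq_span_pderiv [CharP κ p] (c : (Fin n → ℕ) → κ) (i : Fin n) (τ : Fin n → κ)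
    (hM : MultP p n κ c) :
    jac p n κ (step p n κ i τ c) = Ideal.span (Set.range fun s =>
      MvPowerSeries.pderiv s (show MvPowerSeries (Fin n) κ from
        fun A : Fin n →₀ ℕ => tr n κ i τ p (dv n κ i p (bl n κ i (clean p n κ c))) ⇑A)) := by
  rw [jac_eq_span_pderiv]
  have h : (fun s => MvPowerSeries.pderiv s (ser p n κ (step p n κ i τ c))) = fun s =>
      MvPowerSeries.pderiv s (show MvPowerSeries (Fin n) κ from
        fun A : Fin n →₀ ℕ => tr n κ i τ p (dv n κ i p (bl n κ i (clean p n κ c))) ⇑A) :=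
    funext fun s => pderiv_ser_step_eq c i τ hM s
  rw [h]

/-! ## Linear coefficients of `T` -/

/-- `MultP (step i τ c)` (with `MultP c` and `2 ≤ p`) kills the linear coefficients of `T`: a linear
monomial is never a `p`-th power, so it survives the final cleaning, and the cleaned successor has
order `≥ p ≥ 2`. [folklore] -/
theorem coeff_single_serT (hp : 2 ≤ p) (c : (Fin n → ℕ) → κ) (i : Fin n) (τ : Fin n → κ)
    (hM : MultP p n κ c) (hM' : MultP p n κ (step p n κ i τ c)) (s : Fin n) :
    coeff (Finsupp.single s 1) (show MvPowerSeries (Fin n) κ from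
        fun A : Fin n →₀ ℕ => tr n κ i τ p (dv n κ i p (bl n κ i (clean p n κ c))) ⇑A) = 0 := by
  -- the cleaned successor vanishes in degree `1 < p`
  have h1 : clean p n κ (step p n κ i τ c) ⇑(Finsupp.single s 1 : Fin n →₀ ℕ) = 0 := by
    by_contra h
    have := hM'.2 _ h
    rw [← degree_eq_sum_univ, Finsupp.degree_single] at this
    omega
  -- and its coefficient there is the coefficient of `T` (a linear monomial is not a `p`-th power)
  have hns : ¬ ∀ j, p ∣ (⇑(Finsupp.single s 1 : Fin n →₀ ℕ)) j := by
    intro h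
    have := h s
    rw [Finsupp.single_eq_same] at this
    have := Nat.le_of_dvd one_pos this
    omega
  rw [OrdPExitSurface.step_eq i τ hM, CaseAExitOrdSucc.clean_clean,
    OrdPExitSurface.clean_apply_of_not_dvd _ _ s (fun h => hns (fun j => by
      by_cases hj : s = j
      · subst hj; exact h
      · rw [Finsupp.single_apply, if_neg hj]; exact dvd_zero p))] at h1
  exact h1

/-! ## `OrdP` at `p = 2`: a square-free quadratic monomial -/

/-- An exponent of degree `2` with some odd entry is `e_j + e_l` with `j ≠ l`. [folklore] -/
theorem exists_pair_of_sum_two {A : Fin n → ℕ} (hA : Finset.sum Finset.univ (fun j => A j) = 2)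
    (hodd : ¬ ∀ j, 2 ∣ A j) :
    ∃ j l : Fin n, j ≠ l ∧ A = ⇑(Finsupp.single j 1 + Finsupp.single l 1 : Fin n →₀ ℕ) := by
  push Not at hodd
  obtain ⟨j, hj⟩ := hodd
  have hjle : A j ≤ 2 := by
    rw [← hA]; exact Finset.single_le_sum (f := A) (fun _ _ => Nat.zero_le _) (Finset.mem_univ j)
  have hj1 : A j = 1 := by omega
  -- the remaining mass `1` sits at some `l ≠ j`
  have hrest : Finset.sum (Finset.univ.erase j) (fun l => A l) = 1 := by
    have := Finset.add_sum_erase Finset.univ A (Finset.mem_univ j)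
    omega
  obtain ⟨l, hl, hAl⟩ : ∃ l ∈ Finset.univ.erase j, A l ≠ 0 := by
    by_contra h
    push Not at h
    rw [Finset.sum_eq_zero h] at hrest
    exact zero_ne_one hrest
  have hlj : l ≠ j := Finset.ne_of_mem_erase hl
  have hlle : A l ≤ 1 := by
    rw [← hrest]
    exact Finset.single_le_sum (f := A) (fun _ _ => Nat.zero_le _) hl
  have hl1 : A l = 1 := by omega
  -- every other entry vanishes
  have hzero : ∀ m, m ≠ j → m ≠ l → A m = 0 := by
    intro m hmj hml
    have hsplit := Finset.add_sum_erase (Finset.univ.erase j) A (Finset.mem_erase.mpr ⟨hlj, Finset.mem_univ l⟩)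
    rw [hrest, hl1] at hsplit
    have hm : m ∈ (Finset.univ.erase j).erase l := by simp [hmj, hml]
    have := Finset.single_le_sum (f := A) (fun _ _ => Nat.zero_le _) hm
    omega
  refine ⟨j, l, Ne.symm hlj, funext fun m => ?_⟩
  simp only [Finsupp.coe_add, Pi.add_apply, Finsupp.single_apply]
  by_cases hmj : m = j
  · subst hmj; simp [hj1, hlj]
  · by_cases hml : m = l
    · subst hml; simp [hl1, Ne.symm hmj]
    · rw [if_neg (Ne.symm hmj), if_neg (Ne.symm hml), hzero m hmj hml, add_zero]

/-- **`OrdP` in characteristic two is a hyperbolic pair**: the cleaned series has a monomial of degree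
exactly `2` iff it has a non-zero coefficient at some `X_j X_l`, `j ≠ l` (the squares `X_j²` are
`2`-nd powers, deleted by cleaning). [folklore] -/
theorem ordP_two_iff_exists_pair (c : (Fin n → ℕ) → κ) :
    OrdP 2 n κ c ↔ ∃ j l : Fin n, j ≠ l ∧
      coeff (Finsupp.single j 1 + Finsupp.single l 1) (ser 2 n κ c) ≠ 0 := by
  constructor
  · rintro ⟨A, hA, hsum⟩
    have hodd : ¬ ∀ j, 2 ∣ A j := fun h => hA (OrdPExitSurface.clean_apply_of_dvd c A h)
    obtain ⟨j, l, hjl, rfl⟩ := exists_pair_of_sum_two hsum hodd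
    exact ⟨j, l, hjl, by rwa [coeff_ser]⟩
  · rintro ⟨j, l, hjl, h⟩
    refine ⟨⇑(Finsupp.single j 1 + Finsupp.single l 1 : Fin n →₀ ℕ), h, ?_⟩
    rw [← degree_eq_sum_univ, map_add, Finsupp.degree_single, Finsupp.degree_single]

/-! ## The package at `p = 2`, and the stub's conclusion from the formal drop -/

/-- **Piece (D), the char-2 dictionary wrapper** (chain W4.1): for a state `c` of multiplicity `2` whose
successor `step i τ c` has multiplicity `2`, the formal pair `a := ser 2 n κ c`,
`T :=` series of `tr i τ 2 (dv i 2 (bl i (clean c)))` satisfies `2 ≤ ord a`, `T` has no linear terms,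
`X_i² T = a∘Φ_{i,τ}`, and the route's Jacobian ideals of `c` and of `step i τ c` are the
`pderiv`-gradient ideals of `a` and `T`. [folklore] -/
theorem dictCharTwo [CharP κ 2] (c : (Fin n → ℕ) → κ) (i : Fin n) (τ : Fin n → κ)
    (hM : MultP 2 n κ c) (hM' : MultP 2 n κ (step 2 n κ i τ c)) :
    ∃ G : MvPowerSeries (Fin n) κ,
      2 ≤ (ser 2 n κ c).order ∧ (∀ s, coeff (Finsupp.single s 1) G = 0) ∧
      X i ^ 2 * G = subst (fun s => if s = i then (X i : MvPowerSeries (Fin n) κ)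
        else X i * (X s + C (τ s))) (ser 2 n κ c) ∧
      jac 2 n κ c = Ideal.span (Set.range fun s => MvPowerSeries.pderiv s (ser 2 n κ c)) ∧
      jac 2 n κ (step 2 n κ i τ c) = Ideal.span (Set.range fun s => MvPowerSeries.pderiv s G) :=
  ⟨_, two_le_order_ser hM, coeff_single_serT le_rfl c i τ hM hM', X_pow_mul_serT_eq_subst c i τ hM,
    jac_eq_span_pderiv c, jac_step_eq_span_pderiv c i τ hM⟩

/-- **The stub from the formal drop.** If the Milnor number of a formal pair `(a, G)` —
`2 ≤ ord a`, `G` without linear terms, `X_i² G = a∘Φ_{i,τ}`, both Milnor algebras finite — always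
drops (piece (A) = (L)+(S) of the chain, for the given `n`), then the registered stub
`stub_muDropCharTwoOrdP` holds at that `n`: VERBATIM its hypotheses and conclusion (the `OrdP`
hypotheses are not even needed). [folklore] -/
theorem muDrop_of_seriesDrop [CharP κ 2]
    (hdrop : ∀ (i : Fin n) (τ : Fin n → κ) (a G : MvPowerSeries (Fin n) κ),
      2 ≤ a.order → (∀ s, coeff (Finsupp.single s 1) G = 0) →
      X i ^ 2 * G = subst (fun s => if s = i then (X i : MvPowerSeries (Fin n) κ)
        else X i * (X s + C (τ s))) a →
      Module.Finite κ (MvPowerSeries (Fin n) κ ⧸ Ideal.span (Set.range fun s => MvPowerSeries.pderiv s a)) →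
      Module.Finite κ (MvPowerSeries (Fin n) κ ⧸ Ideal.span (Set.range fun s => MvPowerSeries.pderiv s G)) →
      Module.finrank κ (MvPowerSeries (Fin n) κ ⧸ Ideal.span (Set.range fun s => MvPowerSeries.pderiv s G)) <
        Module.finrank κ (MvPowerSeries (Fin n) κ ⧸ Ideal.span (Set.range fun s => MvPowerSeries.pderiv s a)))
    (c : (Fin n → ℕ) → κ) (i : Fin n) (τ : Fin n → κ)
    (hI : Isol 2 n κ c) (hM : MultP 2 n κ c) (hI' : Isol 2 n κ (step 2 n κ i τ c))
    (hM' : MultP 2 n κ (step 2 n κ i τ c)) :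
    mu 2 n κ (step 2 n κ i τ c) < mu 2 n κ c := by
  obtain ⟨G, ha, hG0, hG, hj, hj'⟩ := dictCharTwo c i τ hM hM'
  change Module.Finite κ (MvPowerSeries (Fin n) κ ⧸ jac 2 n κ c) at hI
  change Module.Finite κ (MvPowerSeries (Fin n) κ ⧸ jac 2 n κ (step 2 n κ i τ c)) at hI'
  change Module.finrank κ (MvPowerSeries (Fin n) κ ⧸ jac 2 n κ (step 2 n κ i τ c)) <
    Module.finrank κ (MvPowerSeries (Fin n) κ ⧸ jac 2 n κ c)
  rw [hj] at hI ⊢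
  rw [hj'] at hI' ⊢
  exact hdrop i τ _ G ha hG0 hG hI hI'

/-- **`MuDrop 2 n κ` from the formal drop** — the same, packaged as the route's one-step drop predicate
(`Theorems/WildConesClassicalRegimesDefs.lean`), which is `stub_muDropCharTwoOrdP` at `n` with the two
`OrdP` hypotheses dropped. [folklore] -/
theorem muDrop_two_of_seriesDrop [CharP κ 2]
    (hdrop : ∀ (i : Fin n) (τ : Fin n → κ) (a G : MvPowerSeries (Fin n) κ),
      2 ≤ a.order → (∀ s, coeff (Finsupp.single s 1) G = 0) →
      X i ^ 2 * G = subst (fun s => if s = i then (X i : MvPowerSeries (Fin n) κ)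
        else X i * (X s + C (τ s))) a →
      Module.Finite κ (MvPowerSeries (Fin n) κ ⧸ Ideal.span (Set.range fun s => MvPowerSeries.pderiv s a)) →
      Module.Finite κ (MvPowerSeries (Fin n) κ ⧸ Ideal.span (Set.range fun s => MvPowerSeries.pderiv s G)) →
      Module.finrank κ (MvPowerSeries (Fin n) κ ⧸ Ideal.span (Set.range fun s => MvPowerSeries.pderiv s G)) <
        Module.finrank κ (MvPowerSeries (Fin n) κ ⧸ Ideal.span (Set.range fun s => MvPowerSeries.pderiv s a))) :
    MuDrop 2 n κ :=
  fun c i τ hI hM hI' hM' => muDrop_of_seriesDrop hdrop c i τ hI hM hI' hM'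

/-! ## The registered stub of line `char2_descent` (crux stmt-ResolutionOfSingularities-16343), by name
(`Sig.stub_dictCharTwo` copied VERBATIM from the registered skeleton, sha cd29fd46d9f27a01; `private` so that
no other file's copy can clash — the statement unfolds definitionally to the skeleton's) -/

/-- Registered signature `Sig.stub_dictCharTwo` of the line skeleton `char2_descent` of crux
`IsolatedForcedTermination` (VERBATIM copy): THE CHARACTERISTIC-TWO DICTIONARY WRAPPER, general `n` — for
a state `c` of multiplicity `2` whose successor `step i τ c` has multiplicity `2`, a formal pair `(a, G)`
with `ord a ≥ 2`, `G` without linear terms, `X_i² G = a∘Φ_{i,τ}`, `jac c = (∂a)`, `jac (step i τ c) = (∂G)`.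
A route-posited stub statement (registered on the crux item), not a published result. -/
private def Sig.stub_dictCharTwo : Prop :=
  ∀ (n : ℕ) (κ : Type) [Field κ] [CharP κ 2] (c : (Fin n → ℕ) → κ) (i : Fin n) (τ : Fin n → κ),
    MultP 2 n κ c → MultP 2 n κ (step 2 n κ i τ c) →
    ∃ a G : MvPowerSeries (Fin n) κ, 2 ≤ a.order ∧ (∀ s, coeff (Finsupp.single s 1) G = 0) ∧
      X i ^ 2 * G = subst (fun s => if s = i then (X i : MvPowerSeries (Fin n) κ)
        else X i * (X s + C (τ s))) a ∧
      jac 2 n κ c = Ideal.span (Set.range fun s => MvPowerSeries.pderiv s a) ∧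
      jac 2 n κ (step 2 n κ i τ c) = Ideal.span (Set.range fun s => MvPowerSeries.pderiv s G)

/-- **Registered stub `stub_dictCharTwo` (D)** of the line skeleton `char2_descent` of crux
`IsolatedForcedTermination` (stmt-ResolutionOfSingularities-16343; skeleton sha cd29fd46d9f27a01), by name
and signature: witnesses `a := ser 2 n κ c` and `G :=` the series of `tr i τ 2 (dv i 2 (bl i (clean c)))`;
immediate from `dictCharTwo`. [folklore] -/
theorem stub_dictCharTwo : Sig.stub_dictCharTwo := by
  intro n κ _ _ c i τ hM hM'
  obtain ⟨G, ha, hG0, hG, hj, hj'⟩ := dictCharTwo c i τ hM hM'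
  exact ⟨_, G, ha, hG0, hG, hj, hj'⟩

end MuDropCharTwoOrdP

end Summit.ResolutionOfSingularities.ResolutionOfSingularities.Theorems.WildCones

end
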